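import Summits.AnomalousDissipation.AnomalousDissipation.Theses.TwoAndHalfD
import Literature.Barriers.AnomalousDissipation.GravestModeLaminarAttractorSwept
import Literature.Analysis.FluidPDE.DoeringFoiasPowerProofs

/-!
# Load-bearing constraints of the crux `TwoAndHalfD.TwodBoundedEnergyZeroMomentum` (stmt-AnomalousDissipation-10786)

Negative-side support (cdisprove seat `refuter-cdisprove-stmt-AnomalousDissipation-10786-0`).  The crux
is EXISTENTIAL ("some steady smooth divergence-free mean-zero `g ≠ 0` on `𝕋²` admits, along
`ν_j → 0`, zero-momentum global Leray–Hopf solutions with `sup_j ⟨‖v_j‖²⟩ < ∞`"), so its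
load-bearing analysis asks which clause keeps the CHEAP witnesses out.  Each theorem
`twodBoundedEnergyZeroMomentum_holds_without_…` below is the crux with ONE clause deleted, stated
verbatim and PROVED, by an explicit laminar / Galilean-swept state of the tree
(`marchioroSweptState`) with no turbulence content:

* `…_without_zeroMomentum` (drop `HasZeroMean (v₀ j)`; this is the retired stmt-0209): TRUE by
  Galilean sweeping of the first-mode laminar state (`⟨‖v_j‖²⟩ ≤ 1 + 2/π²`);
* `…_without_vanishingViscosity` (drop `Tendsto ν atTop (𝓝 0)`): TRUE at `ν_j = 1` by the
  laminar spin-up from rest (`⟨‖v_j‖²⟩ ≤ 1/(2π⁴)`, from the zero-momentum coefficient bound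
  `norm_sweptCoeff_zero_le`: NO detuning at zero momentum, response `∝ ν⁻¹`);
* `…_without_nonzeroForce` (drop `g ≠ 0`): TRUE by the rest state.

So a proof of the crux must use the three clauses at once: the witness has to be a genuinely
non-laminar ZERO-MOMENTUM object along `ν_j → 0` (the condensate regime of Gallet–Young 2013;
printed open problem, Constantin–Tarfulea–Vicol 2013, arXiv:1305.7089 p. 3).  Companion file:
`Negative/FirstShellRigidity.lean` (the first-shell restriction of the crux is false).  No new
definitions.
-/

noncomputable section

open MeasureTheory Set Filter Topology UnitAddTorus
open scoped ENNReal NNReal InnerProductSpace ComplexConjugate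

namespace Summit.AnomalousDissipation.AnomalousDissipation.Theorems.TwodBoundedEnergyZeroMomentum.Negative

open Literature.Analysis.FunctionSpaces Literature.Analysis.FunctionSpaces.Torus
open Literature.Analysis.FluidPDE Literature.Analysis.FluidPDE.Torus
open Literature.Barriers.AnomalousDissipation

section LoadBearing

variable {α ν : ℝ}

/-- The first-mode force is admissible for the crux: smooth, divergence free, mean zero. [folklore] -/
theorem marchioroForce_admissible (α : ℝ) :
    IsSmooth (marchioroForce α) ∧ IsDivFree (marchioroForce α) ∧ HasZeroMean (marchioroForce α) := by
  refine ⟨isSmooth_marchioroForce α, ?_, ?_⟩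
  · rw [marchioroForce_eq_realTrigPoly]
    exact isDivFree_realTrigPoly_singleton (sum_mul_firstModeCoeff α)
  · exact hasZeroMean_stokesMode (k := Pi.single 0 1) firstModeFreq_ne_zero _ _

/-- At zero momentum the sweep rate of a non-zero mode has modulus `≥ 4π²ν`. [folklore] -/
theorem le_norm_sweepRate_zero (hν : 0 ≤ ν) {k : (Fin 2 → ℤ)} (hk : k ≠ 0) :
    4 * Real.pi ^ 2 * ν ≤ ‖sweepRate ν 0 k‖ := by
  have h1 : |(sweepRate ν 0 k).re| ≤ ‖sweepRate ν 0 k‖ := Complex.abs_re_le_norm _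
  rw [re_sweepRate] at h1
  have h2 : 1 ≤ freqNormSq k := Literature.Analysis.FluidPDE.one_le_freqNormSq_of_ne_zero hk
  have h3 : 4 * Real.pi ^ 2 * ν ≤ ν * (4 * Real.pi ^ 2 * freqNormSq k) := by
    calc 4 * Real.pi ^ 2 * ν = ν * (4 * Real.pi ^ 2 * 1) := by ring
      _ ≤ ν * (4 * Real.pi ^ 2 * freqNormSq k) := by gcongr
  exact h3.trans ((le_abs_self _).trans h1)

/-- Zero-momentum swept coefficients: `‖ĉ(t)(k)‖ ≤ ‖f̂_α(k)‖/(2π²ν)` (`k ≠ 0`, `t ≥ 0`, `ν > 0`)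
— NO detuning: the response is the full laminar one, `∝ ν⁻¹`. [folklore] -/
theorem norm_sweptCoeff_zero_le (hν : 0 < ν) {t : ℝ} (ht : 0 ≤ t) {k : (Fin 2 → ℤ)} (hk : k ≠ 0) :
    ‖sweptCoeff α ν 0 t k‖ ≤ (2 * Real.pi ^ 2 * ν)⁻¹ * ‖marchioroForceCoeff α k‖ := by
  rw [sweptCoeff_of_ne_zero α ν 0 t hk, norm_smul]
  refine mul_le_mul_of_nonneg_right ?_ (norm_nonneg _)
  rw [sweepFactor, norm_div]
  have hΛ := le_norm_sweepRate_zero hν.le hk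
  calc ‖1 - Complex.exp (-(sweepRate ν 0 k * t))‖ / ‖sweepRate ν 0 k‖
      ≤ 2 / (4 * Real.pi ^ 2 * ν) :=
        div_le_div₀ zero_le_two (norm_one_sub_exp_le (re_sweepRate_nonneg hν.le 0 k) ht)
          (by positivity) hΛ
    _ = (2 * Real.pi ^ 2 * ν)⁻¹ := by
        field_simp
        ring

/-- **Energy of the laminar spin-up from rest** (`marchioroSweptState α ν 0`, datum `0`, zero
momentum): `∫ ‖u(t)‖² ≤ α²/(2π⁴ν²)` for `t ≥ 0` — bounded at fixed `ν`, of laminar size `ν⁻²`. [folklore] -/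
theorem integral_norm_sq_marchioroSweptState_zero_le (hν : 0 < ν) {t : ℝ} (ht : 0 ≤ t) :
    ∫ x, ‖marchioroSweptState α ν 0 t x‖ ^ 2 ≤ α ^ 2 / (2 * Real.pi ^ 4 * ν ^ 2) := by
  rw [integral_norm_sq_marchioroSweptState, ← Finset.add_sum_erase _ _ (zero_mem_freqBall 1),
    sweptCoeff_zero_freq, EuclideanSpace.norm_complexify, norm_zero, zero_pow two_ne_zero, zero_add]
  calc ∑ k ∈ (freqBall 1).erase 0, ‖sweptCoeff α ν 0 t k‖ ^ 2
      ≤ ∑ k ∈ (freqBall 1).erase 0, ((2 * Real.pi ^ 2 * ν)⁻¹ * ‖marchioroForceCoeff α k‖) ^ 2 :=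
        Finset.sum_le_sum fun k hk =>
          pow_le_pow_left₀ (norm_nonneg _)
            (norm_sweptCoeff_zero_le hν ht (Finset.ne_of_mem_erase hk)) 2
    _ = (2 * Real.pi ^ 2 * ν)⁻¹ ^ 2 * ∑ k ∈ (freqBall 1).erase 0, ‖marchioroForceCoeff α k‖ ^ 2 := by
        rw [Finset.mul_sum]
        exact Finset.sum_congr rfl fun k _ => by ring
    _ ≤ (2 * Real.pi ^ 2 * ν)⁻¹ ^ 2 * (2 * α ^ 2) := by
        gcongr
        exact sum_norm_sq_marchioroForceCoeff_le α _
    _ = α ^ 2 / (2 * Real.pi ^ 4 * ν ^ 2) := by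
        field_simp

/-- Mean energy of the laminar spin-up from rest: `⟨‖u‖²⟩ ≤ α²/(2π⁴ν²)`. [folklore] -/
theorem meanEnergy_marchioroSweptState_zero_le (hν : 0 < ν) :
    meanEnergy (marchioroSweptState α ν 0) ≤ α ^ 2 / (2 * Real.pi ^ 4 * ν ^ 2) :=
  meanEnergy_le_of_forall_le fun _ ht => integral_norm_sq_marchioroSweptState_zero_le hν ht.le

/-- The zero field on `(UnitAddTorus (Fin 2))` has zero mean. [folklore] -/
theorem hasZeroMean_zero : HasZeroMean (fun _ : (UnitAddTorus (Fin 2)) => (0 : (EuclideanSpace ℝ (Fin 2)))) := by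
  simp [HasZeroMean]

/-- **Zero momentum is load-bearing**: without it the crux HOLDS, by Galilean sweeping of the
first-mode laminar state (datum `≡ e₀`, `⟨‖v_j‖²⟩ ≤ 1 + 2/π²` uniformly in `ν_j = 1/(j+1)`;
the tree's `marchioroSweptState`). Any proof of the crux must therefore exploit a mechanism that
survives at total momentum zero. [folklore] -/
theorem twodBoundedEnergyZeroMomentum_holds_without_zeroMomentum :
    ∃ g : (UnitAddTorus (Fin 2)) → (EuclideanSpace ℝ (Fin 2)), IsSmooth g ∧ IsDivFree g ∧ HasZeroMean g ∧ g ≠ 0 ∧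
      ∃ (ν : ℕ → ℝ) (v₀ : ℕ → (UnitAddTorus (Fin 2)) → (EuclideanSpace ℝ (Fin 2))) (v : ℕ → ℝ → (UnitAddTorus (Fin 2)) → (EuclideanSpace ℝ (Fin 2))),
        (∀ j, 0 < ν j) ∧ Tendsto ν atTop (𝓝 0) ∧ (∀ j, MemLp (v₀ j) 2 volume) ∧
        (∀ j, Torus.IsGlobalLerayHopf (ν j) (fun _ => g) (v₀ j) (v j)) ∧
        ∃ E : ℝ, ∀ j, meanEnergy (v j) ≤ E := by
  set m : (EuclideanSpace ℝ (Fin 2)) := EuclideanSpace.single 0 1 with hm_def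
  have hm : m 0 ≠ 0 := by simp [hm_def]
  have hν : ∀ j : ℕ, (0 : ℝ) < 1 / ((j : ℝ) + 1) := fun j => by positivity
  obtain ⟨hs, hd, hz⟩ := marchioroForce_admissible 1
  exact ⟨marchioroForce 1, hs, hd, hz, marchioroForce_ne_zero one_ne_zero,
    fun j => 1 / ((j : ℝ) + 1), fun _ _ => m, fun j => marchioroSweptState 1 (1 / ((j : ℝ) + 1)) m, hν,
    tendsto_one_div_add_atTop_nhds_zero_nat, fun _ => memLp_const m,
    fun j => marchioroSweptState_isGlobalLerayHopf_const 1 (hν j) m,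
    ⟨‖m‖ ^ 2 + 2 * (1 : ℝ) ^ 2 / (Real.pi ^ 2 * (m 0) ^ 2), fun j =>
      meanEnergy_marchioroSweptState_le (hν j).le hm⟩⟩

/-- **`ν_j → 0` is load-bearing**: at fixed viscosity (`ν_j = 1`) the laminar spin-up from rest
under the first-mode force is a zero-momentum family with `⟨‖v_j‖²⟩ ≤ 1/(2π⁴)`. [folklore] -/
theorem twodBoundedEnergyZeroMomentum_holds_without_vanishingViscosity :
    ∃ g : (UnitAddTorus (Fin 2)) → (EuclideanSpace ℝ (Fin 2)), IsSmooth g ∧ IsDivFree g ∧ HasZeroMean g ∧ g ≠ 0 ∧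
      ∃ (ν : ℕ → ℝ) (v₀ : ℕ → (UnitAddTorus (Fin 2)) → (EuclideanSpace ℝ (Fin 2))) (v : ℕ → ℝ → (UnitAddTorus (Fin 2)) → (EuclideanSpace ℝ (Fin 2))),
        (∀ j, 0 < ν j) ∧ (∀ j, MemLp (v₀ j) 2 volume ∧ HasZeroMean (v₀ j)) ∧
        (∀ j, Torus.IsGlobalLerayHopf (ν j) (fun _ => g) (v₀ j) (v j)) ∧
        ∃ E : ℝ, ∀ j, meanEnergy (v j) ≤ E := by
  obtain ⟨hs, hd, hz⟩ := marchioroForce_admissible 1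
  refine ⟨marchioroForce 1, hs, hd, hz, marchioroForce_ne_zero one_ne_zero, fun _ => 1,
    fun _ _ => 0, fun _ => marchioroSweptState 1 1 0, fun _ => one_pos,
    fun _ => ⟨memLp_const 0, hasZeroMean_zero⟩,
    fun _ => marchioroSweptState_isGlobalLerayHopf_const 1 one_pos 0,
    ⟨(1 : ℝ) ^ 2 / (2 * Real.pi ^ 4 * (1 : ℝ) ^ 2), fun _ =>
      meanEnergy_marchioroSweptState_zero_le one_pos⟩⟩

/-- **`g ≠ 0` is load-bearing** (trivially): with the amplitude-`0` force the rest state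
(`marchioroSweptState 0 ν 0`, energy `≤ 0`) is a zero-momentum bounded-energy family along
`ν_j = 1/(j+1) → 0`. [folklore] -/
theorem twodBoundedEnergyZeroMomentum_holds_without_nonzeroForce :
    ∃ g : (UnitAddTorus (Fin 2)) → (EuclideanSpace ℝ (Fin 2)), IsSmooth g ∧ IsDivFree g ∧ HasZeroMean g ∧
      ∃ (ν : ℕ → ℝ) (v₀ : ℕ → (UnitAddTorus (Fin 2)) → (EuclideanSpace ℝ (Fin 2))) (v : ℕ → ℝ → (UnitAddTorus (Fin 2)) → (EuclideanSpace ℝ (Fin 2))),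
        (∀ j, 0 < ν j) ∧ Tendsto ν atTop (𝓝 0) ∧
        (∀ j, MemLp (v₀ j) 2 volume ∧ HasZeroMean (v₀ j)) ∧
        (∀ j, Torus.IsGlobalLerayHopf (ν j) (fun _ => g) (v₀ j) (v j)) ∧
        ∃ E : ℝ, ∀ j, meanEnergy (v j) ≤ E := by
  have hν : ∀ j : ℕ, (0 : ℝ) < 1 / ((j : ℝ) + 1) := fun j => by positivity
  obtain ⟨hs, hd, hz⟩ := marchioroForce_admissible 0
  refine ⟨marchioroForce 0, hs, hd, hz, fun j => 1 / ((j : ℝ) + 1), fun _ _ => 0,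
    fun j => marchioroSweptState 0 (1 / ((j : ℝ) + 1)) 0, hν,
    tendsto_one_div_add_atTop_nhds_zero_nat, fun _ => ⟨memLp_const 0, hasZeroMean_zero⟩,
    fun j => marchioroSweptState_isGlobalLerayHopf_const 0 (hν j) 0, ⟨0, fun j => ?_⟩⟩
  have h := meanEnergy_marchioroSweptState_zero_le (α := 0) (hν j)
  simpa using h

end LoadBearing

end Summit.AnomalousDissipation.AnomalousDissipation.Theorems.TwodBoundedEnergyZeroMomentum.Negative

end
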